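import Summits.Ventures.DiscreteObjects.PP12.OrderElevenHomologyNormal

/-!
# PP(12), order-11 cell, Case A: the MULTIPLIER symmetry of normal homology arrays
Framing: lottery ticket; floor = certified bounds/negative ranges.

Cell pub-namedobj (venture DiscreteObjects), target (M), designs gen 22 (P11-SIZING.md). A unit `u` of `ZMod 11` acts on normal
arrays (`Homology12.IsNormal`, `OrderElevenHomologyNormal`): scale every entry by `u` and relabel the indices `1..11` by the
permutation `mulPerm u` (`0 ↦ 0`, `j ↦ u·(j−1) + 1`) that re-sorts row `0`. **`IsNormal.mulAct`**: the result is normal again.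
This is the symmetry that cuts the depth-1 blocking certificate of Case A from `3,441` second rows to `363` orbit representatives
(designs g22 code/p11/caseA_orbit.py). No `sorry`, no new axioms; nothing here asserts a census statement.
-/

namespace Summit.Ventures.DiscreteObjects.PP12

namespace Homology12

/-- the index relabelling of a multiplier: `0 ↦ 0`, `j ↦ u·(j − 1) + 1` (indices `1..11` carry the values `0..10` of row `0`) -/
def mulMap (u : ZMod 11) (j : Fin 12) : Fin 12 :=
  if j = 0 then 0 else ⟨(u * (((j : ℕ) : ZMod 11) - 1)).val + 1, by have := (u * (((j : ℕ) : ZMod 11) - 1)).val_lt; omega⟩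

/-- `mulMap` fixes `0` -/
theorem mulMap_zero (u : ZMod 11) : mulMap u 0 = 0 := rfl

/-- the value carried by `mulMap u j`, `j ≠ 0`: `(mulMap u j) − 1 = u · (j − 1)` in `ZMod 11` -/
theorem mulMap_val {u : ZMod 11} {j : Fin 12} (hj : j ≠ 0) : (((mulMap u j : Fin 12) : ℕ) : ZMod 11) = u * (((j : ℕ) : ZMod 11) - 1) + 1 := by
  unfold mulMap; rw [if_neg hj]; push_cast; rw [ZMod.natCast_zmod_val]

/-- `mulMap u j ≠ 0` for `j ≠ 0` -/
theorem mulMap_ne_zero {u : ZMod 11} {j : Fin 12} (hj : j ≠ 0) : mulMap u j ≠ 0 := by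
  unfold mulMap; rw [if_neg hj]; exact fun e => by have := congrArg Fin.val e; simp at this

/-- `mulMap u` is injective for a unit `u` -/
theorem mulMap_injective {u : ZMod 11} (hu : u ≠ 0) : Function.Injective (mulMap u) := by
  haveI : Fact (Nat.Prime 11) := ⟨by norm_num⟩
  intro j j' e
  by_cases hj : j = 0
  · subst hj
    by_contra hj'
    exact mulMap_ne_zero (Ne.symm hj') (e.symm.trans (mulMap_zero u))
  · by_cases hj' : j' = 0
    · subst hj'; exact absurd (e.trans (mulMap_zero u)) (mulMap_ne_zero hj)
    · have h1 := mulMap_val (u := u) hj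
      have h2 := mulMap_val (u := u) hj'
      rw [e] at h1
      have h3 : u * (((j : ℕ) : ZMod 11) - 1) = u * (((j' : ℕ) : ZMod 11) - 1) := add_right_cancel (h1.symm.trans h2)
      have h4 : (((j : ℕ) : ZMod 11) - 1) = (((j' : ℕ) : ZMod 11) - 1) := mul_left_cancel₀ hu h3
      have h5 : ((j : ℕ) : ZMod 11) = ((j' : ℕ) : ZMod 11) := sub_left_injective h4
      have hjv : (j : ℕ) - 1 < 11 := by have := j.2; omega
      have hj'v : (j' : ℕ) - 1 < 11 := by have := j'.2; omega
      have e6 : (((j : ℕ) - 1 : ℕ) : ZMod 11) = (((j' : ℕ) - 1 : ℕ) : ZMod 11) := by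
        have hj1 : 1 ≤ (j : ℕ) := Nat.one_le_iff_ne_zero.2 fun h => hj (Fin.ext h)
        have hj'1 : 1 ≤ (j' : ℕ) := Nat.one_le_iff_ne_zero.2 fun h => hj' (Fin.ext h)
        rw [Nat.cast_sub hj1, Nat.cast_sub hj'1, h5]
      have := (ZMod.natCast_eq_natCast_iff' _ _ 11).1 e6
      rw [Nat.mod_eq_of_lt hjv, Nat.mod_eq_of_lt hj'v] at this
      exact Fin.ext (by omega)

/-- the multiplier permutation of the indices -/
noncomputable def mulPerm {u : ZMod 11} (hu : u ≠ 0) : Fin 12 ≃ Fin 12 :=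
  Equiv.ofBijective (mulMap u) ((mulMap_injective hu).bijective_of_finite)

/-- `mulPerm` is `mulMap` -/
theorem mulPerm_apply {u : ZMod 11} (hu : u ≠ 0) (j : Fin 12) : mulPerm hu j = mulMap u j := rfl

/-- the inverse of `mulPerm` fixes `0` -/
theorem mulPerm_symm_zero {u : ZMod 11} (hu : u ≠ 0) : (mulPerm hu).symm 0 = 0 := by
  rw [Equiv.symm_apply_eq]; rfl

/-- **the multiplier action on arrays**: scale by `u`, relabel rows and columns by `mulPerm u` -/
noncomputable def mulAct {u : ZMod 11} (hu : u ≠ 0) (a : Fin 12 → Fin 12 → ZMod 11) (i j : Fin 12) : ZMod 11 :=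
  u * a ((mulPerm hu).symm i) ((mulPerm hu).symm j)

/-- **normal arrays stay normal under the multiplier action** -/
theorem IsNormal.mulAct {a : Fin 12 → Fin 12 → ZMod 11} (ha : IsNormal a) {u : ZMod 11} (hu : u ≠ 0) : IsNormal (mulAct hu a) := by
  haveI : Fact (Nat.Prime 11) := ⟨by norm_num⟩
  set π := mulPerm hu with hπ
  have hπ0 : π.symm 0 = 0 := mulPerm_symm_zero hu
  have ne : ∀ {i j : Fin 12}, i ≠ j → π.symm i ≠ π.symm j := fun h e => h (π.symm.injective e)
  refine ⟨?_, ?_, ?_, ?_⟩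
  · intro j hj
    show u * a (π.symm 0) (π.symm j) + 1 = _
    rw [hπ0]
    have hj' : π.symm j ≠ 0 := fun e => hj (by rw [← hπ0] at e; exact π.symm.injective e)
    have h0 := ha.row0 (π.symm j) hj'
    have hv := mulMap_val (u := u) hj'
    rw [← mulPerm_apply hu, ← hπ, Equiv.apply_symm_apply] at hv
    rw [hv, ← h0]; ring
  · intro i j j' hji hj'i hjj' e
    exact ha.latin _ _ _ (ne hji) (ne hj'i) (ne hjj') (mul_left_cancel₀ hu e)
  · intro i i' j hii' hji hji' e
    exact ha.ne_of_ne _ _ _ (ne hii') (ne hji) (ne hji') (mul_left_cancel₀ hu e)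
  · intro i i' hii' j j' hjj' hji hji' hj'i hj'i' e
    apply ha.diff_ne _ _ (ne hii') _ _ (ne hjj') (ne hji) (ne hji') (ne hj'i) (ne hj'i')
    have : u * (a (π.symm i) (π.symm j) - a (π.symm i') (π.symm j)) = u * (a (π.symm i) (π.symm j') - a (π.symm i') (π.symm j')) := by
      rw [mul_sub, mul_sub]; exact e
    exact mul_left_cancel₀ hu this

/-- reading the action on a row: `mulAct u a i (mulPerm u j) = u · a (π⁻¹ i) j` -/
theorem mulAct_apply_perm {u : ZMod 11} (hu : u ≠ 0) (a : Fin 12 → Fin 12 → ZMod 11) (i j : Fin 12) :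
    mulAct hu a i (mulPerm hu j) = u * a ((mulPerm hu).symm i) j := by
  unfold mulAct; rw [Equiv.symm_apply_apply]

end Homology12

end Summit.Ventures.DiscreteObjects.PP12
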